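import Mathlib.Algebra.Polynomial.BigOperators
import Mathlib.Algebra.Polynomial.Degree.Support
import Mathlib.Algebra.Polynomial.Roots
import Mathlib.Analysis.SpecificLimits.Normed
import Mathlib.Computability.Encoding
import Mathlib.Data.Nat.Log
import Mathlib.RingTheory.Polynomial.Pochhammer
import Mathlib.RingTheory.Polynomial.Vieta
import Literature.Computability.AlgebraicComplexity.TauConjecture
import Literature.Computability.Complexity.CircuitClasses
import Literature.Computability.Complexity.CountingHierarchy
import Literature.Computability.Complexity.CountingHierarchyProofs
import HarnessLib

/-!
# Bürgisser's transfer theorem: decomposition and assembly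

Companion ("Proofs") file of `Literature.Computability.AlgebraicComplexity.TauConjecture` for the
named fact `Literature.Computability.AlgebraicComplexity.not_isPBounded_constantFreeComplexity_perPoly_of_tauConjecture`
(Bürgisser: the Shub–Smale τ-conjecture implies that `τ(PER_n)` is not polynomially bounded).
The printed proof (ECCC TR06-113 = Comput. Complexity 18 (2009), proof of Thm. 1.1(2), p. 15)
is a five-line assembly of two deep intermediate results, which we vendor as named facts
(D-0014) with the source's numbering, and we PROVE the assembly:

* `pochhammerWilkinson n = ∏_{k=1}^{n} (X - k) ∈ ℤ[X]` (the Pochhammer–Wilkinson polynomial),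
  with `n` distinct integer roots (`card_roots_toFinset_pochhammerWilkinson`), coefficients
  `(-1)^{n-k} σ_{n-k}(1,…,n)` (`coeff_pochhammerWilkinson`), and equal to Mathlib's
  `(descPochhammer ℤ n).comp (X - 1)` (`pochhammerWilkinson_eq_descPochhammer_comp`).
* Definability of integer sequences in the counting hierarchy (Bürgisser, Def. 3.1):
  `IsDefinableIn K q a` for a doubly indexed sequence `a n k` (`k ≤ q n`) and a class `K` of
  languages, `IsCHDefinable = IsDefinableIn CH`, `IsCHPolyDefinable = IsDefinableIn (CH/poly)`,
  and the singly indexed versions `IsDefinableIn₁`, `IsCHDefinable₁`, `IsCHPolyDefinable₁`.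
* Named facts: Lemma 2.12 (`PP_subset_PPoly_of_isPBounded_perPoly`), Cor. 3.8
  (`Burgisser2009_factorial_chDefinable`), Cor. 3.9 (`Burgisser2009_esymm_chDefinable`), the
  sentence "Corollary 3.9 implies that its coefficient sequence is definable in CH" of the proof
  of Thm. 1.1(2) (`Burgisser2009_pochhammerWilkinson_coeff_chDefinable`), Thm. 4.1(1)
  (`Burgisser2009_thm41_1`), Thm. 4.1(2) (`Burgisser2009_thm41_2`, hypothesis "definable in
  CH/poly" as printed) and its uniform special case (`Burgisser2009_thm41_2_uniform`, hypothesis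
  "definable in CH"; a corollary of the printed statement since CH ⊆ CH/poly, Def. 2.4).
* PROVED assembly `not_isPBounded_constantFreeComplexity_perPoly_of_tauConjecture_of`:
  the two facts `Burgisser2009_pochhammerWilkinson_coeff_chDefinable` and
  `Burgisser2009_thm41_2_uniform` imply the target fact, exactly as on p. 15 of the source:
  `τ(2^{e(n)} f_n) ≤ (log n)^{c}` while `2^{e(n)} f_n` has `n` integer roots, contradicting
  `z(f) ≤ (1 + τ(f))^{c₀}` for `n = 2^m` large (`exists_pow_log_lt`).

The discharge `not_isPBounded_constantFreeComplexity_perPoly_of_tauConjecture_holds` therefore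
reduces to discharging the two vendored facts; Thm. 4.1(2) in turn rests on Lemma 2.12
(#P-completeness of the permanent, Valiant 1979), Lemma 2.5 (`CH_subset_PPoly_of_PP_subset_PPoly`),
Thm. 2.10 (constant-free VNP-completeness of PER), Thm. 2.11 (Koiran 2004, Thm. 6.1) and, for
Cor. 3.9, on Thm. 3.4/3.7 (Dlogtime-uniform TC⁰ Chinese remaindering, Hesse–Allender–Barrington
2002, scaled up to CH). None of these is in Mathlib or the tree.

## Conventions

* `τ` is the library's `constantFreeComplexity` (fan-in-two, constants and sum coefficients in
  `{0, 1, -1}`), equal to Shub–Smale's/Bürgisser's `τ` up to a factor `≤ 3`; all statements here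
  are invariant under constant factors on `τ` (bounds of the form `(log₂ n + 2) ^ c`, `∃ c`).
  `tauPoly f` views `f : ℤ[X]` in `MvPolynomial (Fin 1) ℤ` exactly as `ShubSmaleTauConjecture`
  does; `tauInt a = tauPoly (C a)`.
* "`g(n) = (log n)^{O(1)}`" is rendered `∃ c, ∀ n, g n ≤ (Nat.log 2 n + 2) ^ c` (base `≥ 2`, so
  finitely many small `n` and constant factors are absorbed by `c`; equivalent to the source's
  asymptotic form since all quantities are finite).
* Integers `n, k, j` are encoded in binary by Mathlib's `Computability.encodeNat`, tuples by the
  library pairing `boolPair`; the languages `Sgn(a)`, `Bit(|a|)` of Def. 3.1 are only constrained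
  on the index domain `k ≤ q n` (promise form: `∃ S ∈ K, ∀ n k, k ≤ q n → (… ∈ S ↔ …)`). This is
  what the printed proofs support: in the proof of Thm. 4.1(2) (p. 14) the truncation at `q(n)`
  is effected through the bits of `q(n)` fed to Thm. 2.11, so the values of the languages off the
  domain are never used. The literal alternative (`enc (n, k) ∈ S ↔ k ≤ q n ∧ 0 ≤ a n k`) is
  equivalent whenever `q` is polynomial-time computable, which covers every application here
  (`q = id`).
* Declaration names of the vendored facts carry `Burgisser2009` (the journal publication, bib key
  `Burgisser2009`, as in the target fact's cite); the `[cite: …]` locators carry `Burgisser2006`,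
  the ECCC report actually read, whose numbering is quoted (see the last bullet).
* Source read: the ECCC report TR06-113 (Aug. 2006; bib key `Burgisser2006`), whose numbering
  (Lemma 2.5, 2.12, Thm. 2.10, 2.11, Def. 3.1, Thm. 3.4, 3.7, Cor. 3.8, 3.9, Thm. 4.1, Thm. 1.1) is
  used in the cites; the journal version is `Burgisser2009` (there the target is "Main Thm. 1.2").

## References

* P. Bürgisser, *On defining integers in the counting hierarchy and proving lower bounds in
  algebraic complexity*, ECCC TR06-113 (2006); journal version *On defining integers and proving
  arithmetic circuit lower bounds*, Comput. Complexity 18 (2009) 81–103; STACS 2007.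
* P. Koiran, *Valiant's model and the cost of computing integers*, Comput. Complexity 13 (2004)
  131–146, Thm. 6.1, Lemma 4.4.
* W. Hesse, E. Allender, D. A. M. Barrington, *Uniform constant-depth threshold circuits for
  division and iterated multiplication*, JCSS 65 (2002) 695–716, Thm. 4.1, Lemma 4.1.
* L. G. Valiant, *The complexity of computing the permanent*, TCS 8 (1979) 189–201.
* M. Shub, S. Smale, Duke Math. J. 81 (1995) 47–54 (τ-conjecture).
-/

noncomputable section

open Polynomial Filter
open Literature.Computability.Complexity Computability

namespace Literature.Computability.AlgebraicComplexity

/-! ### `τ` of univariate integer polynomials and of integers -/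

/-- `τ(f)` for a univariate integer polynomial `f ∈ ℤ[X]`: the constant-free complexity of `f`
viewed in `MvPolynomial (Fin 1) ℤ` through `MvPolynomial.uniqueAlgEquiv`, exactly the quantity
bounded in `ShubSmaleTauConjecture` (Bürgisser, ECCC TR06-113, Def. 2.6; Shub–Smale 1995). [cite: Burgisser2006, Def. 2.6] -/
def tauPoly (f : Polynomial ℤ) : ℕ :=
  constantFreeComplexity ((MvPolynomial.uniqueAlgEquiv ℤ (Fin 1)).symm f)

/-- `τ(a)` for an integer `a`: the cost of building the constant polynomial `a` from `1` by
`+, -, ×` (Bürgisser, ECCC TR06-113, Def. 2.6: "it makes sense to consider the τ-complexity of an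
integer k"), as `tauPoly (C a)`. [cite: Burgisser2006, Def. 2.6] -/
def tauInt (a : ℤ) : ℕ :=
  tauPoly (Polynomial.C a)

/-- Unfolding lemma (definitional). [cite: Burgisser2006, Def. 2.6] -/
theorem tauPoly_def (f : Polynomial ℤ) :
    tauPoly f = constantFreeComplexity ((MvPolynomial.uniqueAlgEquiv ℤ (Fin 1)).symm f) :=
  rfl

/-! ### The Pochhammer–Wilkinson polynomials -/

/-- The multiset `{1, 2, …, n}` of integers (the roots of the Pochhammer–Wilkinson polynomial;
Bürgisser, ECCC TR06-113, proof of Thm. 1.1(2)). [cite: Burgisser2006, proof of Thm. 1.1(2)] -/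
def pwRoots (n : ℕ) : Multiset ℤ :=
  (Multiset.range n).map fun k : ℕ => (↑k + 1 : ℤ)

/-- The Pochhammer–Wilkinson polynomial `f_n = ∏_{k=1}^{n} (X - k) ∈ ℤ[X]` (Bürgisser, ECCC
TR06-113, abstract and proof of Thm. 1.1(2)). In terms of Mathlib's falling factorial polynomial,
`f_n = (descPochhammer ℤ n).comp (X - 1)` (`pochhammerWilkinson_eq_descPochhammer_comp`); the
product-of-linear-factors form is kept as the definition because the roots and Vieta lemmas
apply to it directly. [cite: Burgisser2006, proof of Thm. 1.1(2)] -/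
def pochhammerWilkinson (n : ℕ) : Polynomial ℤ :=
  ((pwRoots n).map fun a => X - C a).prod

/-- `{1, …, n}` has `n` elements. [folklore] -/
@[simp]
theorem card_pwRoots (n : ℕ) : Multiset.card (pwRoots n) = n := by
  simp [pwRoots]

/-- The elements `1, …, n` are distinct. [folklore] -/
theorem nodup_pwRoots (n : ℕ) : (pwRoots n).Nodup := by
  refine (Multiset.nodup_range n).map ?_
  intro a b h
  have : (a : ℤ) = b := by linarith
  exact_mod_cast this

/-- Membership in `{1, …, n}`. [cite: Burgisser2006, proof of Thm. 1.1(2)] -/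
theorem mem_pwRoots_iff {n : ℕ} {a : ℤ} : a ∈ pwRoots n ↔ 1 ≤ a ∧ a ≤ n := by
  constructor
  · rintro h
    obtain ⟨k, hk, rfl⟩ := Multiset.mem_map.1 h
    rw [Multiset.mem_range] at hk
    constructor <;> omega
  · rintro ⟨h1, h2⟩
    refine Multiset.mem_map.2 ⟨(a - 1).toNat, ?_, ?_⟩
    · rw [Multiset.mem_range]; omega
    · rw [Int.toNat_of_nonneg (by omega)]; ring

/-- `f_n` is monic. [cite: Burgisser2006, proof of Thm. 1.1(2)] -/
theorem monic_pochhammerWilkinson (n : ℕ) : (pochhammerWilkinson n).Monic :=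
  monic_multiset_prod_of_monic _ _ fun a _ => monic_X_sub_C a

/-- `f_n ≠ 0` (it is monic). [cite: Burgisser2006, proof of Thm. 1.1(2)] -/
theorem pochhammerWilkinson_ne_zero (n : ℕ) : pochhammerWilkinson n ≠ 0 :=
  (monic_pochhammerWilkinson n).ne_zero

/-- `f_0 = 1` (empty product). [folklore] -/
theorem pochhammerWilkinson_zero : pochhammerWilkinson 0 = 1 := by
  simp [pochhammerWilkinson, pwRoots]

/-- `f_{n+1} = (X - (n+1)) · f_n`. [folklore] -/
theorem pochhammerWilkinson_succ (n : ℕ) :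
    pochhammerWilkinson (n + 1) = (X - C ((n : ℤ) + 1)) * pochhammerWilkinson n := by
  simp [pochhammerWilkinson, pwRoots, Multiset.range_succ, Multiset.map_cons, Multiset.prod_cons]

/-- Comparison with Mathlib: `f_n` is the falling factorial polynomial
`descPochhammer ℤ n = X (X-1) ⋯ (X-n+1)` shifted by one, `f_n = (descPochhammer ℤ n).comp (X - 1)`
(induction with `descPochhammer_succ_right`). [folklore] -/
theorem pochhammerWilkinson_eq_descPochhammer_comp (n : ℕ) :
    pochhammerWilkinson n = (descPochhammer ℤ n).comp (X - 1) := by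
  induction n with
  | zero => simp [pochhammerWilkinson_zero]
  | succ n ih =>
    rw [pochhammerWilkinson_succ, descPochhammer_succ_right, mul_comp, ← ih, sub_comp, X_comp,
      natCast_comp, map_add, map_one, map_natCast]
    ring

/-- `deg f_n = n`. [cite: Burgisser2006, proof of Thm. 1.1(2)] -/
@[simp]
theorem natDegree_pochhammerWilkinson (n : ℕ) : (pochhammerWilkinson n).natDegree = n := by
  rw [pochhammerWilkinson, natDegree_multiset_prod_X_sub_C_eq_card, card_pwRoots]

/-- The roots of `f_n` (with multiplicity) are exactly `1, …, n`. [cite: Burgisser2006, proof of Thm. 1.1(2)] -/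
@[simp]
theorem roots_pochhammerWilkinson (n : ℕ) : (pochhammerWilkinson n).roots = pwRoots n :=
  roots_multiset_prod_X_sub_C _

/-- `f_n` "has exactly `n` integer roots" (Bürgisser, ECCC TR06-113, proof of Thm. 1.1(2)). [cite: Burgisser2006, proof of Thm. 1.1(2)] -/
theorem card_roots_toFinset_pochhammerWilkinson (n : ℕ) :
    (pochhammerWilkinson n).roots.toFinset.card = n := by
  rw [roots_pochhammerWilkinson, Multiset.toFinset_card_of_nodup (nodup_pwRoots n), card_pwRoots]

/-- Vieta: `f_n = ∑_{k=0}^{n} (-1)^k σ_k(1,…,n) X^{n-k}`, i.e. the coefficient of `X^k` in `f_n` is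
`(-1)^{n-k} σ_{n-k}(1,…,n)` for `k ≤ n` (Bürgisser, ECCC TR06-113, proof of Thm. 1.1(2)). [cite: Burgisser2006, proof of Thm. 1.1(2)] -/
theorem coeff_pochhammerWilkinson {n k : ℕ} (hk : k ≤ n) :
    (pochhammerWilkinson n).coeff k = (-1) ^ (n - k) * (pwRoots n).esymm (n - k) := by
  have h := Multiset.prod_X_sub_C_coeff (pwRoots n) (k := k) (by simpa using hk)
  simpa [pochhammerWilkinson] using h

/-- `f_n` as the sum of its monomials up to degree `n` (the shape used in Thm. 4.1(2)). [cite: Burgisser2006, proof of Thm. 1.1(2)] -/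
theorem sum_range_coeff_pochhammerWilkinson (n : ℕ) :
    ∑ k ∈ Finset.range (n + 1), C ((pochhammerWilkinson n).coeff k) * X ^ k =
      pochhammerWilkinson n :=
  (as_sum_range_C_mul_X_pow' _ (by rw [natDegree_pochhammerWilkinson]; exact Nat.lt_succ_self n)).symm

/-! ### Integers definable in the counting hierarchy (Bürgisser, Def. 3.1) -/

/-- Binary encoding of the index pair `(n, k)`: `⟨bin n, bin k⟩` via `boolPair` and Mathlib's
`Computability.encodeNat` (Bürgisser, ECCC TR06-113, §3: "the integers n, k, j represented in
binary"). [cite: Burgisser2006, §3] -/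
def encIdx (n k : ℕ) : List Bool :=
  boolPair (encodeNat n) (encodeNat k)

/-- Binary encoding of the bit query `(n, k, j, b)`: `⟨⟨bin n, bin k⟩, ⟨bin j, [b]⟩⟩`
(Bürgisser, ECCC TR06-113, §3). [cite: Burgisser2006, §3] -/
def encBitQuery (n k j : ℕ) (b : Bool) : List Bool :=
  boolPair (encIdx n k) (boolPair (encodeNat j) [b])

/-- Polynomial bitsize, condition (4) of Bürgisser, ECCC TR06-113, §3: there is a constant `c`
with `|a(n, k)| ≤ 2^{n^c}` for all `n > 1` and `k ≤ q(n)`. [cite: Burgisser2006, §3 (4)] -/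
def HasPolyBitsize (q : ℕ → ℕ) (a : ℕ → ℕ → ℤ) : Prop :=
  ∃ c : ℕ, ∀ n k, 1 < n → k ≤ q n → |a n k| ≤ 2 ^ (n ^ c)

/-- **Definability of an integer sequence in a class `K`** (Bürgisser, ECCC TR06-113, Def. 3.1,
with the class as a parameter so that `K = CH` and `K = CH/poly` are the two printed instances):
a doubly indexed sequence `a(n, k)`, `0 ≤ k ≤ q(n)` with `q` polynomially bounded and `a` of
polynomial bitsize, is definable in `K` iff the sign language
`Sgn(a) = {(n, k) | a(n, k) ≥ 0}` and the bit language
`Bit(|a|) = {(n, k, j, b) | the j-th bit of |a(n, k)| equals b}` (indices in binary) belong to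
`K`. The languages are constrained only on the index domain `k ≤ q(n)`. [cite: Burgisser2006, Def. 3.1] -/
def IsDefinableIn (K : Set (Language Bool)) (q : ℕ → ℕ) (a : ℕ → ℕ → ℤ) : Prop :=
  IsPBounded q ∧ HasPolyBitsize q a ∧
    (∃ S ∈ K, ∀ n k, k ≤ q n → (encIdx n k ∈ S ↔ 0 ≤ a n k)) ∧
    ∃ B ∈ K, ∀ n k j (b : Bool), k ≤ q n →
      (encBitQuery n k j b ∈ B ↔ (a n k).natAbs.testBit j = b)

/-- `a` is **definable in the counting hierarchy** `CH` (Bürgisser, ECCC TR06-113, Def. 3.1). [cite: Burgisser2006, Def. 3.1] -/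
def IsCHDefinable (q : ℕ → ℕ) (a : ℕ → ℕ → ℤ) : Prop :=
  IsDefinableIn CH q a

/-- `a` is **definable in `CH/poly`**, the nonuniform version (`polyAdvice`, Bürgisser Def. 2.4)
of `CH` (Bürgisser, ECCC TR06-113, Def. 3.1). [cite: Burgisser2006, Def. 3.1] -/
def IsCHPolyDefinable (q : ℕ → ℕ) (a : ℕ → ℕ → ℤ) : Prop :=
  IsDefinableIn (polyAdvice CH) q a

/-- Singly indexed version of `IsDefinableIn` (the case `t = 0` of Bürgisser, ECCC TR06-113,
Def. 3.1 and the sentence after it): `a(n)` of polynomial bitsize `|a(n)| ≤ 2^{n^c}` (`n > 1`)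
with `Sgn(a) = {n | a(n) ≥ 0}` and `Bit(|a|) = {(n, j, b) | bit j of |a(n)| is b}` in `K`,
`n, j` in binary. [cite: Burgisser2006, Def. 3.1] -/
def IsDefinableIn₁ (K : Set (Language Bool)) (a : ℕ → ℤ) : Prop :=
  (∃ c : ℕ, ∀ n, 1 < n → |a n| ≤ 2 ^ (n ^ c)) ∧
    (∃ S ∈ K, ∀ n, encodeNat n ∈ S ↔ 0 ≤ a n) ∧
    ∃ B ∈ K, ∀ n j (b : Bool),
      boolPair (encodeNat n) (boolPair (encodeNat j) [b]) ∈ B ↔ (a n).natAbs.testBit j = b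

/-- A sequence `(a(n))` is definable in `CH` (Bürgisser, ECCC TR06-113, Def. 3.1, `t = 0`). [cite: Burgisser2006, Def. 3.1] -/
def IsCHDefinable₁ (a : ℕ → ℤ) : Prop :=
  IsDefinableIn₁ CH a

/-- A sequence `(a(n))` is definable in `CH/poly` (Bürgisser, ECCC TR06-113, Def. 3.1, `t = 0`). [cite: Burgisser2006, Def. 3.1] -/
def IsCHPolyDefinable₁ (a : ℕ → ℤ) : Prop :=
  IsDefinableIn₁ (polyAdvice CH) a

/-- Definability is monotone in the class (immediate from the definition; used with
`CH ⊆ CH/poly`). [cite: Burgisser2006, Def. 3.1] -/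
theorem IsDefinableIn.mono {K K' : Set (Language Bool)} (h : K ⊆ K') {q : ℕ → ℕ}
    {a : ℕ → ℕ → ℤ} (ha : IsDefinableIn K q a) : IsDefinableIn K' q a := by
  obtain ⟨hq, hb, ⟨S, hS, hS'⟩, ⟨B, hB, hB'⟩⟩ := ha
  exact ⟨hq, hb, ⟨S, h hS, hS'⟩, ⟨B, h hB, hB'⟩⟩

/-- Definability is monotone in the class, singly indexed version. [cite: Burgisser2006, Def. 3.1] -/
theorem IsDefinableIn₁.mono {K K' : Set (Language Bool)} (h : K ⊆ K') {a : ℕ → ℤ}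
    (ha : IsDefinableIn₁ K a) : IsDefinableIn₁ K' a := by
  obtain ⟨hb, ⟨S, hS, hS'⟩, ⟨B, hB, hB'⟩⟩ := ha
  exact ⟨hb, ⟨S, h hS, hS'⟩, ⟨B, h hB, hB'⟩⟩

/-! ### The vendored intermediate results (named facts, D-0014) -/

/-- **Bürgisser's Lemma 2.12**: `τ(Per_n) = n^{O(1)}` implies `PP ⊆ P/poly` (evaluate the
polynomial-size constant-free circuit for `Per_n` modulo a prime `n! < p_n ≤ 2^{n^{O(1)}}` given
as advice; the 0/1 permanent is #P-complete, Valiant 1979) (Bürgisser, ECCC TR06-113,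
Lemma 2.12). Here `τ = constantFreeComplexity` and `Per_n = perPoly (Fin n) ℤ`. [cite: Burgisser2006, Lemma 2.12] -/
def PP_subset_PPoly_of_isPBounded_perPoly : Prop :=
  IsPBounded (fun n => constantFreeComplexity (perPoly (Fin n) ℤ)) → PP ⊆ PPoly

/-- **Bürgisser's Corollary 3.8**: the sequence of factorials `(n!)` is definable in `CH`; more
generally the falling factorials `(n (n-1) ⋯ (n-k+1))_{k ≤ n}` are definable in `CH`
(Bürgisser, ECCC TR06-113, Cor. 3.8, from Thm. 3.7 and Rem. 3.2). [cite: Burgisser2006, Cor. 3.8] -/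
def Burgisser2009_factorial_chDefinable : Prop :=
  IsCHDefinable₁ (fun n => (n.factorial : ℤ)) ∧
    IsCHDefinable (fun n => n) fun n k => (n.descFactorial k : ℤ)

/-- **Bürgisser's Corollary 3.9**: the sequence of elementary symmetric functions
`(σ_k(1, 2, …, n))_{n ∈ ℕ, k ≤ n}` is definable in `CH` (Bürgisser, ECCC TR06-113, Cor. 3.9;
proof: read the bits of `σ_k` off `(2^{n²}+1)⋯(2^{n²}+n)`, Thm. 3.7). Here
`σ_k(1,…,n) = (pwRoots n).esymm k`. [cite: Burgisser2006, Cor. 3.9] -/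
def Burgisser2009_esymm_chDefinable : Prop :=
  IsCHDefinable (fun n => n) fun n k => (pwRoots n).esymm k

/-- **Coefficient sequence of the Pochhammer–Wilkinson polynomials is definable in `CH`**: for
`f_n = ∏_{k=1}^{n} (X - k) = ∑_{k=0}^{n} (-1)^k σ_k(1,…,n) X^{n-k}`, the sequence
`(coeff of X^k in f_n)_{n, k ≤ n}` is definable in `CH` (Bürgisser, ECCC TR06-113, proof of
Thm. 1.1(2), p. 15: "Corollary 3.9 implies that its coefficient sequence is definable in CH" —
Cor. 3.9 plus the reindexing `k ↦ n - k` and the sign `(-1)^{n-k}`, both polynomial-time). [cite: Burgisser2006, proof of Thm. 1.1(2)] -/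
def Burgisser2009_pochhammerWilkinson_coeff_chDefinable : Prop :=
  IsCHDefinable (fun n => n) fun n k => (pochhammerWilkinson n).coeff k

/-- **Bürgisser's Theorem 4.1(1)**: if `τ(Per_n) = n^{O(1)}` then every sequence of integers
`(a(n))` definable in `CH/poly` is easy to compute, `τ(a(n)) = (log n)^{O(1)}` (Bürgisser, ECCC
TR06-113, Thm. 4.1(1); proof via Lemma 2.12, Lemma 2.5, Thm. 2.11 = Koiran 2004 Thm. 6.1,
Thm. 2.10 and Koiran's Lemma 4.4). Rendering: `∃ c, ∀ n, τ(a n) ≤ (log₂ n + 2)^c`. [cite: Burgisser2006, Thm. 4.1(1)] -/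
def Burgisser2009_thm41_1 : Prop :=
  IsPBounded (fun n => constantFreeComplexity (perPoly (Fin n) ℤ)) →
    ∀ a : ℕ → ℤ, IsCHPolyDefinable₁ a → ∃ c : ℕ, ∀ n, tauInt (a n) ≤ (Nat.log 2 n + 2) ^ c

/-- **Bürgisser's Theorem 4.1(2)**: let `f_n = ∑_{k=0}^{q(n)} b(n,k) X^k ∈ ℤ[X]` with
`(b(n,k))_{n, k ≤ q(n)}` definable in `CH/poly` (in particular `q` polynomially bounded). If
`τ(Per_n) = n^{O(1)}`, then `τ(2^{e(n)} f_n) = (log n)^{O(1)}` for some polynomially bounded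
sequence `(e(n))` in `ℕ` (Bürgisser, ECCC TR06-113, Thm. 4.1(2)). Rendering: `τ = tauPoly`
(`constantFreeComplexity`, Shub–Smale's `τ` up to a factor `≤ 3`), the bound as
`(log₂ n + 2)^c`. [cite: Burgisser2006, Thm. 4.1(2)] -/
def Burgisser2009_thm41_2 : Prop :=
  IsPBounded (fun n => constantFreeComplexity (perPoly (Fin n) ℤ)) →
    ∀ (q : ℕ → ℕ) (b : ℕ → ℕ → ℤ), IsCHPolyDefinable q b →
      ∃ e : ℕ → ℕ, IsPBounded e ∧ ∃ c : ℕ, ∀ n,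
        tauPoly (C ((2 : ℤ) ^ e n) * ∑ k ∈ Finset.range (q n + 1), C (b n k) * X ^ k) ≤
          (Nat.log 2 n + 2) ^ c

/-- **Bürgisser's Theorem 4.1(2), uniform hypothesis**: the same conclusion for coefficient
sequences definable in `CH` (rather than `CH/poly`). This is the special case of the printed
Thm. 4.1(2) through `CH ⊆ CH/poly` (Def. 2.4), and it is the form in which Thm. 4.1(2) is applied
in the proof of Thm. 1.1(2) (p. 15) to the `CH`-definable coefficients of Cor. 3.9. Vendored
separately because `CH ⊆ CH/poly` needs closure of the levels `CₖP` under a padding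
transduction, a machine construction the library keeps as a named fact. [cite: Burgisser2006, Thm. 4.1(2)] -/
def Burgisser2009_thm41_2_uniform : Prop :=
  IsPBounded (fun n => constantFreeComplexity (perPoly (Fin n) ℤ)) →
    ∀ (q : ℕ → ℕ) (b : ℕ → ℕ → ℤ), IsCHDefinable q b →
      ∃ e : ℕ → ℕ, IsPBounded e ∧ ∃ c : ℕ, ∀ n,
        tauPoly (C ((2 : ℤ) ^ e n) * ∑ k ∈ Finset.range (q n + 1), C (b n k) * X ^ k) ≤
          (Nat.log 2 n + 2) ^ c

/-- The uniform form of Thm. 4.1(2) follows from the printed one and `CH ⊆ CH/poly`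
(monotonicity of definability in the class). [cite: Burgisser2006, Thm. 4.1(2)] -/
theorem Burgisser2009_thm41_2_uniform_of (h : Burgisser2009_thm41_2) (hCH : CH ⊆ polyAdvice CH) :
    Burgisser2009_thm41_2_uniform :=
  fun hP q b hb => h hP q b (IsDefinableIn.mono hCH hb)

/-! ### Growth lemma: `(log₂ n)^{O(1)}` is eventually smaller than `n` -/

/-- For every exponent `d` there is `m ≥ 1` with `(m + 2) ^ d < 2 ^ m` (polynomial versus
exponential growth; from Mathlib's `tendsto_pow_const_div_const_pow_of_one_lt`). [folklore] -/
theorem exists_add_two_pow_lt_two_pow (d : ℕ) : ∃ m : ℕ, 1 ≤ m ∧ (m + 2) ^ d < 2 ^ m := by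
  have ht := tendsto_pow_const_div_const_pow_of_one_lt d (show (1 : ℝ) < 2 by norm_num)
  have hev : ∀ᶠ n : ℕ in atTop, (n : ℝ) ^ d / 2 ^ n < 1 / 4 :=
    ht.eventually (gt_mem_nhds (by norm_num))
  obtain ⟨N, hN⟩ := eventually_atTop.1 hev
  refine ⟨max N 3 - 2, by omega, ?_⟩
  set n₀ := max N 3 with hn₀
  have hn₀2 : 2 ≤ n₀ := by omega
  have h1 : (n₀ : ℝ) ^ d / 2 ^ n₀ < 1 / 4 := hN n₀ (le_max_left _ _)
  have h2 : (n₀ : ℝ) ^ d < 2 ^ (n₀ - 2) := by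
    rw [div_lt_iff₀ (by positivity)] at h1
    have : (2 : ℝ) ^ n₀ = 2 ^ (n₀ - 2) * 4 := by
      rw [show n₀ = (n₀ - 2) + 2 from by omega, pow_add]
      norm_num
    linarith
  have h3 : n₀ - 2 + 2 = n₀ := by omega
  rw [h3]
  exact_mod_cast h2

/-- For all constants `c, c₀` there is `n` with `((log₂ n + 2)^c + 2)^{c₀} < n` (take `n = 2^m`
with `m` from `exists_add_two_pow_lt_two_pow`). [folklore] -/
theorem exists_pow_log_lt (c c₀ : ℕ) : ∃ n : ℕ, ((Nat.log 2 n + 2) ^ c + 2) ^ c₀ < n := by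
  obtain ⟨m, hm1, hm⟩ := exists_add_two_pow_lt_two_pow ((c + 1) * c₀)
  refine ⟨2 ^ m, ?_⟩
  rw [Nat.log_pow (by norm_num)]
  have hstep : (m + 2) ^ c + 2 ≤ (m + 2) ^ (c + 1) := by
    have h1 : 1 ≤ (m + 2) ^ c := Nat.one_le_pow _ _ (by omega)
    calc (m + 2) ^ c + 2 ≤ (m + 2) ^ c * 3 := by omega
      _ ≤ (m + 2) ^ c * (m + 2) := Nat.mul_le_mul_left _ (by omega)
      _ = (m + 2) ^ (c + 1) := (pow_succ _ _).symm
  calc ((m + 2) ^ c + 2) ^ c₀ ≤ ((m + 2) ^ (c + 1)) ^ c₀ := Nat.pow_le_pow_left hstep _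
    _ = (m + 2) ^ ((c + 1) * c₀) := (pow_mul _ _ _).symm
    _ < 2 ^ m := hm

/-! ### Assembly: proof of Bürgisser's Thm. 1.1(2) from Cor. 3.9 and Thm. 4.1(2) -/

/-- **Proof of Bürgisser's Theorem 1.1(2)** (ECCC TR06-113, p. 15; journal: Main Thm. 1.2), as an
implication between named facts: if the coefficient sequence of the Pochhammer–Wilkinson
polynomials `f_n = ∏_{k=1}^{n}(X - k)` is definable in `CH` (Cor. 3.9) and Thm. 4.1(2) holds (for
`CH`-definable coefficient sequences), then the τ-conjecture implies that `τ(PER_n)` is not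
polynomially bounded. Printed argument: assuming `τ(Per_n) = n^{O(1)}`, Thm. 4.1(2) gives
`τ(2^{e(n)} f_n) ≤ (log₂ n + 2)^c`; but `2^{e(n)} f_n` has the `n` distinct integer roots
`1, …, n`, so the τ-conjecture forces `n ≤ ((log₂ n + 2)^c + 2)^{c₀}` for all `n`, which fails for
`n = 2^m` large. [cite: Burgisser2006, proof of Thm. 1.1(2)] -/
theorem not_isPBounded_constantFreeComplexity_perPoly_of_tauConjecture_of
    (h₁ : Burgisser2009_pochhammerWilkinson_coeff_chDefinable)
    (h₂ : Burgisser2009_thm41_2_uniform) :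
    not_isPBounded_constantFreeComplexity_perPoly_of_tauConjecture := by
  intro hτ hP
  obtain ⟨c₀, hc₀⟩ := hτ
  obtain ⟨e, -, c, hc⟩ := h₂ hP (fun n => n) (fun n k => (pochhammerWilkinson n).coeff k) h₁
  -- the polynomials `g n = 2^{e n} f_n`
  set g : ℕ → Polynomial ℤ := fun n => C ((2 : ℤ) ^ e n) * pochhammerWilkinson n with hg
  have hg_ne : ∀ n, g n ≠ 0 := fun n =>
    mul_ne_zero (C_ne_zero.2 (pow_ne_zero _ two_ne_zero)) (pochhammerWilkinson_ne_zero n)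
  have hτg : ∀ n, tauPoly (g n) ≤ (Nat.log 2 n + 2) ^ c := fun n => by
    simpa only [hg, sum_range_coeff_pochhammerWilkinson] using hc n
  -- `g n` has at least `n` distinct integer roots
  have hroots : ∀ n, n ≤ (g n).roots.toFinset.card := fun n => by
    have hle : (pochhammerWilkinson n).roots ≤ (g n).roots :=
      roots.le_of_dvd (hg_ne n) (dvd_mul_left _ _)
    calc n = (pochhammerWilkinson n).roots.toFinset.card :=
          (card_roots_toFinset_pochhammerWilkinson n).symm
      _ ≤ (g n).roots.toFinset.card :=
          Finset.card_le_card (Multiset.toFinset_subset.2 (Multiset.subset_of_le hle))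
  -- the τ-conjecture bound
  have key : ∀ n, n ≤ ((Nat.log 2 n + 2) ^ c + 2) ^ c₀ := fun n =>
    calc n ≤ (g n).roots.toFinset.card := hroots n
      _ ≤ (tauPoly (g n) + 2) ^ c₀ := hc₀ (g n) (hg_ne n)
      _ ≤ ((Nat.log 2 n + 2) ^ c + 2) ^ c₀ :=
          Nat.pow_le_pow_left (Nat.add_le_add_right (hτg n) 2) _
  obtain ⟨n, hn⟩ := exists_pow_log_lt c c₀
  exact absurd (key n) (not_le.2 hn)

/-! ### `CH ⊆ CH/poly`: the uniform form of Thm. 4.1(2) is a special case of the printed one -/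

/-- With `CH ⊆ CH/poly` proved (`Literature.Computability.Complexity.CH_subset_polyAdvice_CH`, empty advice; the levels
`CₖP` are closed under polynomial-time reductions, `CountingHierarchyProofs.lean`), the uniform form
`Burgisser2009_thm41_2_uniform` follows from the printed Thm. 4.1(2) alone. [cite: Burgisser2006, Thm. 4.1(2)] -/
theorem Burgisser2009_thm41_2_uniform_of_thm41_2 (h : Burgisser2009_thm41_2) :
    Burgisser2009_thm41_2_uniform :=
  Burgisser2009_thm41_2_uniform_of h CH_subset_polyAdvice_CH

/-- `CH`-definable sequences are `CH/poly`-definable (Bürgisser, ECCC TR06-113, Def. 3.1 with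
Def. 2.4), by `CH ⊆ CH/poly`. [cite: Burgisser2006, Def. 3.1] -/
theorem IsCHDefinable.isCHPolyDefinable {q : ℕ → ℕ} {a : ℕ → ℕ → ℤ} (h : IsCHDefinable q a) :
    IsCHPolyDefinable q a :=
  IsDefinableIn.mono CH_subset_polyAdvice_CH h

/-- Singly indexed version: `CH`-definable sequences are `CH/poly`-definable. [cite: Burgisser2006, Def. 3.1] -/
theorem IsCHDefinable₁.isCHPolyDefinable₁ {a : ℕ → ℤ} (h : IsCHDefinable₁ a) :
    IsCHPolyDefinable₁ a :=
  IsDefinableIn₁.mono CH_subset_polyAdvice_CH h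

/-- **Proof of Bürgisser's Theorem 1.1(2) from Cor. 3.9 (coefficient form) and the printed
Thm. 4.1(2)** (for `CH/poly`-definable coefficients): the two remaining named facts of the
decomposition. [cite: Burgisser2006, proof of Thm. 1.1(2)] -/
theorem not_isPBounded_constantFreeComplexity_perPoly_of_tauConjecture_of'
    (h₁ : Burgisser2009_pochhammerWilkinson_coeff_chDefinable) (h₂ : Burgisser2009_thm41_2) :
    not_isPBounded_constantFreeComplexity_perPoly_of_tauConjecture :=
  not_isPBounded_constantFreeComplexity_perPoly_of_tauConjecture_of h₁
    (Burgisser2009_thm41_2_uniform_of_thm41_2 h₂)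

end Literature.Computability.AlgebraicComplexity
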